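/- Free lead seat `ym-line-cbag-p1` (prover-ym-line-cbag-p1-g20-0; own crux `BoxFloorAllGroups` stmt-QuantumFields-22254 CLOSED) on the
planner-of-record's LINE 5, route `HankelDensitySplitting`, crux `HankelDensityFloor` (stmt-QuantumFields-26618), towards registered stub 1
`stub_hankelFixedDistanceLower` (the cross-plane fixed-distance law): the second-order local free-gluon law for an ARBITRARY PAIR of plaquettes.
Helper file (`--supports stmt-QuantumFields-26618`).  RECORD-type material; the Yang–Mills mass gap is NOT proved by anything here. -/
import Summits.QuantumFields.YangMills.Theorems.DirichletWindowLocalGaussianitySecondOrder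
import HarnessLib

/-!
# The second-order local free-gluon law for an arbitrary pair of plaquettes

Pair version of the tree\'s `LocalGaussianityExpMomentTangentLaw.SecondOrder.secondOrder_of_expMoment` (route `DirichletWindow`, item 12314,
which treats the two in-line `(0,1)`-plaquettes `(0;0,1)`, `(n e₀;0,1)`): for a compact simple `G` and a faithful unitary `r`, GIVEN the free-energy
asymptotics `f_r(β) + (3D_r/2) log β → K` (item 8759, closed) and uniform exponential moments `∫ exp((β/2)(N − Re tr r(U_p))) dμ ≤ C` of the scaled
cost at EVERY plaquette `p` over torus-limit states at large `β`, there is `D ≥ 1` with, for all plaquettes `p, q` and every `ε > 0`, eventually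
in `β` and uniformly over `μ ∈ infiniteVolumeLimitPoints r.ρ β`,

`|β² · plaquetteCorr r.ρ μ p q − (D/2) · (curvatureTwoPoint p q)²| < ε`.

The proof is the tree\'s, verbatim up to the indexing: the joint tangent law (T0) of `EquipartitionPinsProbe.stub_tangent` holds for ANY finite
family of plaquettes; rigidity identifies the tangent law with `curvatureGaussianField 4 D`; truncation at level `M` costs `O(1/M)` uniformly by
the exponential moments (`abs_cov_sub_truncated_le`); and `GaussMoments.tendsto_truncated_cov D p q` is stated for arbitrary `p, q`.  Also:
`cov_scaled_eq_fun` (covariance of affinely rescaled observables).  This is the input of the cross-plane fixed-distance floor of the crux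
`HankelDensityFloor` (stub 1).  References: S. Chatterjee, arXiv:1602.01222 §§11–14; arXiv:1803.01950 Problem 5.1.  NOT the Yang–Mills mass gap.
-/

noncomputable section

open MeasureTheory Filter Topology
open Literature.MathematicalPhysics.QuantumFieldTheory Literature.MathematicalPhysics.QuantumLattice
open Summit.QuantumFields.YangMills.Theorems.LocalGaussianityExpMomentTangentLaw
open Summit.QuantumFields.YangMills.Theorems.LocalGaussianityExpMomentTangentLaw.SecondOrder

namespace Summit.QuantumFields.YangMills.Theorems.HankelDensitySplitting

namespace PairLaw

/-! ### Covariance of affinely rescaled observables -/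

/-- For a probability measure and integrable `f, g, f·g`: `Cov(β(c − f), β(c − g)) = β² · Cov(f, g)` (raw-integral form). [folklore] -/
theorem cov_scaled_eq_fun {Ω : Type*} [MeasurableSpace Ω] (μ : Measure Ω) [IsProbabilityMeasure μ] (β c : ℝ)
    {f g : Ω → ℝ} (hf : Integrable f μ) (hg : Integrable g μ) (hfg : Integrable (fun ω => f ω * g ω) μ) :
    (∫ ω, (β * (c - f ω)) * (β * (c - g ω)) ∂μ) - (∫ ω, β * (c - f ω) ∂μ) * (∫ ω, β * (c - g ω) ∂μ) =
      β ^ 2 * ((∫ ω, f ω * g ω ∂μ) - (∫ ω, f ω ∂μ) * ∫ ω, g ω ∂μ) := by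
  have hprod : ∀ ω, (β * (c - f ω)) * (β * (c - g ω)) =
      β ^ 2 * c ^ 2 - β ^ 2 * c * g ω - β ^ 2 * c * f ω + β ^ 2 * (f ω * g ω) := fun ω => by ring
  have hlin : ∀ {h : Ω → ℝ}, Integrable h μ → ∫ ω, β * (c - h ω) ∂μ = β * c - β * ∫ ω, h ω ∂μ := by
    intro h hh
    rw [integral_const_mul, integral_sub (integrable_const _) hh, integral_const, probReal_univ, one_smul]
    ring
  simp_rw [hprod]
  have i1 : Integrable (fun ω => β ^ 2 * c ^ 2 - β ^ 2 * c * g ω - β ^ 2 * c * f ω) μ :=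
    ((integrable_const _).sub (hg.const_mul _)).sub (hf.const_mul _)
  have i2 : Integrable (fun ω => β ^ 2 * (f ω * g ω)) μ := hfg.const_mul _
  have i3 : Integrable (fun ω => β ^ 2 * c ^ 2 - β ^ 2 * c * g ω) μ := (integrable_const _).sub (hg.const_mul _)
  have i4 : Integrable (fun ω => β ^ 2 * c * g ω) μ := hg.const_mul _
  have i5 : Integrable (fun ω => β ^ 2 * c * f ω) μ := hf.const_mul _
  rw [integral_add i1 i2, integral_sub i3 i5, integral_sub (integrable_const _) i4, integral_const,
    probReal_univ, one_smul, integral_const_mul, integral_const_mul, integral_const_mul, hlin hf, hlin hg]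
  ring

/-! ### The pair law (contradiction wrapper, as the tree's axial version) -/

open Summit.QuantumFields.YangMills.Theorems.EquipartitionPinsProbe in
/-- **The second-order local free-gluon law for an ARBITRARY PAIR of plaquettes, from the tangent law and chessboard exponential
moments** (pair version of `SecondOrder.secondOrder_of_expMoment`).  For a compact simple `G` (Borel σ-algebra) and a faithful unitary
lattice representation `r`, GIVEN the free-energy asymptotics `f_r(β) + (3D_r/2) log β → K` and uniform exponential moments of the scaled
plaquette costs at EVERY plaquette over torus-limit states at large `β`: there is `D ≥ 1` such that for all plaquettes `p, q` of `ℤ⁴` and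
every `ε > 0` there is `β₁` with `|β² Cov_μ(Re tr r(U_p), Re tr r(U_q)) − (D/2) · (curvatureTwoPoint p q)²| < ε` for all `β ≥ β₁` and all
`μ ∈ infiniteVolumeLimitPoints r.ρ β` — the joint tangent law (T0) of `EquipartitionPinsProbe.stub_tangent` at the two plaquettes, rigidity,
uniform integrability by truncation, Isserlis under `curvatureGaussianField 4 D` (`GaussMoments.tendsto_truncated_cov`). [folklore] -/
theorem secondOrder_pair_of_expMoment :
    ∀ (G : Type) [Group G] [TopologicalSpace G] [IsTopologicalGroup G] [CompactSpace G],
      IsCompactSimpleLieGroup G →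
      letI : MeasurableSpace G := borel G
      haveI : BorelSpace G := ⟨rfl⟩
      ∀ r : LatticeRep G,
        (∃ K : ℝ, Tendsto (fun β : ℝ => freeEnergyDensity 4 r.ρ β +
          (3 * (Module.finrank ℝ ↥(Submodule.span ℝ {X : Matrix (Fin r.N) (Fin r.N) ℂ |
            ∀ t : ℝ, NormedSpace.exp ((t : ℂ) • X) ∈ Set.range r.ρ}) : ℝ) / 2) * Real.log β) atTop (nhds K)) →
        (∃ C β₁ : ℝ, ∀ β : ℝ, β₁ ≤ β → ∀ μ ∈ infiniteVolumeLimitPoints (d := 4) r.ρ β,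
          ∀ pp : ZdPlaquette 4,
            ∫ U, Real.exp (β / 2 * ((r.N : ℝ) - plaquetteObs r.ρ pp.1 pp.2.1.1 pp.2.1.2 U)) ∂μ ≤ C) →
        ∃ D : ℕ, 0 < D ∧ ∀ (p q : ZdPlaquette 4) (ε : ℝ), 0 < ε → ∃ β₁ : ℝ, ∀ β : ℝ, β₁ ≤ β →
          ∀ μ ∈ infiniteVolumeLimitPoints (d := 4) r.ρ β,
            |β ^ 2 * plaquetteCorr r.ρ μ p.1 p.2.1.1 p.2.1.2 q.1 q.2.1.1 q.2.1.2 -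
              (D : ℝ) / 2 * curvatureTwoPoint p q ^ 2| < ε := by
  intro G _ _ _ _ hG
  letI : MeasurableSpace G := borel G
  haveI : BorelSpace G := ⟨rfl⟩
  intro r hK hexp
  haveI : SecondCountableTopology G :=
    (r.continuous.isClosedEmbedding r.injective).isEmbedding.secondCountableTopology
  obtain ⟨D, hD, hTan⟩ := stub_tangent G hG r (stub_equipartition G hG r hK)
  have hR := stub_rigidity
    (stub_factorization (stub_exactShiftInvariance stub_steinFlow stub_kernelFixesExact)
      (stub_cubeShiftInvariance stub_kernelClosed) stub_density)
    stub_cosMoment stub_lineVariance stub_gaussFromCharFun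
  obtain ⟨C, β₁, hC⟩ := hexp
  refine ⟨D, hD, fun p0 pn ε hε => ?_⟩
  set L : ℝ := (D : ℝ) / 2 * curvatureTwoPoint p0 pn ^ 2 with hL
  by_contra hcon
  push Not at hcon
  choose βs hβs μs hμs hbad using fun k : ℕ => hcon (max (k : ℝ) β₁)
  have hβk : ∀ k : ℕ, (k : ℝ) ≤ βs k := fun k => (le_max_left _ _).trans (hβs k)
  have hβ1 : ∀ k, β₁ ≤ βs k := fun k => (le_max_right _ _).trans (hβs k)
  have hβ0 : ∀ k, 0 ≤ βs k := fun k => (Nat.cast_nonneg k).trans (hβk k)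
  have hβtend : Tendsto βs atTop atTop := tendsto_atTop_mono hβk tendsto_natCast_atTop_atTop
  obtain ⟨φ, τ, hφ, hτ, hT0, hT1, hT2, hT3⟩ := hTan βs μs hβtend hμs
  have hτeq : τ = curvatureGaussianField 4 D := hR D τ hτ hT1 hT2 hT3
  subst hτeq
  have hprob : ∀ k, IsProbabilityMeasure (μs k) := fun k => by
    obtain ⟨Lk, -, hP, -⟩ := hμs k
    exact hP
  -- the plaquette observables and the scaled costs
  have hPc : ∀ x : ZdPlaquette 4, Continuous (plaquetteObs r.ρ x.1 x.2.1.1 x.2.1.2) :=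
    fun x => continuous_plaquetteObs r.ρ r.continuous x.1 x.2.1.1 x.2.1.2
  have hPabs : ∀ (x : ZdPlaquette 4) (U : LGConfig 4 G),
      |plaquetteObs r.ρ x.1 x.2.1.1 x.2.1.2 U| ≤ r.N := fun x U => by
    have h := Literature.RepresentationTheory.CompactGroups.CompactGroup.abs_re_trace_le_card r.ρ r.continuous
      (plaquetteHolonomyZd U x.1 x.2.1.1 x.2.1.2)
    simpa only [Fintype.card_fin, plaquetteObs] using h
  have hPi : ∀ (k : ℕ) (x : ZdPlaquette 4), Integrable (plaquetteObs r.ρ x.1 x.2.1.1 x.2.1.2) (μs k) :=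
    fun k x => by
      haveI := hprob k
      exact integrable_of_abs_le (hPc x).aestronglyMeasurable (hPabs x)
  have hPPi : ∀ (k : ℕ) (x y : ZdPlaquette 4),
      Integrable (fun U => plaquetteObs r.ρ x.1 x.2.1.1 x.2.1.2 U * plaquetteObs r.ρ y.1 y.2.1.1 y.2.1.2 U) (μs k) :=
    fun k x y => by
    haveI := hprob k
    exact integrable_of_abs_le ((hPc x).mul (hPc y)).aestronglyMeasurable (K := (r.N : ℝ) * r.N) fun U => by
      rw [abs_mul]
      exact mul_le_mul (hPabs x U) (hPabs y U) (abs_nonneg _) (Nat.cast_nonneg _)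
  set X : ℕ → ZdPlaquette 4 → LGConfig 4 G → ℝ :=
    fun k x U => βs k * ((r.N : ℝ) - plaquetteObs r.ρ x.1 x.2.1.1 x.2.1.2 U) with hX
  have hX0 : ∀ k x U, 0 ≤ X k x U := fun k x U =>
    mul_nonneg (hβ0 k) (sub_nonneg.2 (abs_le.1 (hPabs x U)).2)
  have hXB : ∀ k x U, X k x U ≤ βs k * (2 * r.N) := fun k x U =>
    mul_le_mul_of_nonneg_left (by linarith [(abs_le.1 (hPabs x U)).1]) (hβ0 k)
  have hXm : ∀ k x, AEStronglyMeasurable (X k x) (μs k) := fun k x =>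
    (continuous_const.mul (continuous_const.sub (hPc x))).aestronglyMeasurable
  have hXe : ∀ (k : ℕ) (x : ZdPlaquette 4),
      ∫ U, Real.exp (X k x U / 2) ∂(μs k) ≤ C := fun k x => by
    have h := hC (βs k) (hβ1 k) (μs k) (hμs k) x
    have heq : (fun U => Real.exp (X k x U / 2)) =
        fun U => Real.exp (βs k / 2 * ((r.N : ℝ) - plaquetteObs r.ρ x.1 x.2.1.1 x.2.1.2 U)) := by
      funext U
      congr 1
      simp only [hX]
      ring
    rw [heq]
    exact h
  -- uniform truncation error (the exponential moments give uniform integrability)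
  have htrunc : ∀ (k : ℕ) {M : ℝ}, 0 < M →
      |((∫ U, X k p0 U * X k pn U ∂(μs k)) - (∫ U, X k p0 U ∂(μs k)) * (∫ U, X k pn U ∂(μs k))) -
        ((∫ U, min (max (X k p0 U) 0) M * min (max (X k pn U) 0) M ∂(μs k)) -
          (∫ U, min (max (X k p0 U) 0) M ∂(μs k)) * (∫ U, min (max (X k pn U) 0) M ∂(μs k)))| ≤
        (96 * C + 32 * C ^ 2) / M := fun k M hM => by
    haveI := hprob k
    exact abs_cov_sub_truncated_le (hXm k p0) (hXm k pn) (hX0 k p0) (hX0 k pn) (hXB k p0) (hXB k pn)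
      (hXe k p0) (hXe k pn) hM
  -- the covariance of the scaled costs is `β²` times the pair correlation
  have hcov : ∀ k, (∫ U, X k p0 U * X k pn U ∂(μs k)) - (∫ U, X k p0 U ∂(μs k)) * (∫ U, X k pn U ∂(μs k)) =
      βs k ^ 2 * plaquetteCorr r.ρ (μs k) p0.1 p0.2.1.1 p0.2.1.2 pn.1 pn.2.1.1 pn.2.1.2 := fun k => by
    haveI := hprob k
    exact cov_scaled_eq_fun (μs k) (βs k) (r.N : ℝ) (hPi k p0) (hPi k pn) (hPPi k p0 pn)
  -- the Gaussian side: truncated covariances → `L`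
  have hGauss := GaussMoments.tendsto_truncated_cov D p0 pn
  have hKM : Tendsto (fun M : ℕ => (96 * C + 32 * C ^ 2) / (M : ℝ)) atTop (𝓝 0) :=
    tendsto_const_div_atTop_nhds_zero_nat _
  have hε3 : 0 < ε / 3 := by positivity
  obtain ⟨M, hM1, hMG, hMK⟩ : ∃ M : ℕ, 1 ≤ M ∧
      dist ((∫ Y, min (max ((1 / 2 : ℝ) * ∑ a : Fin D, (Y p0 a) ^ 2) 0) (M : ℝ) *
          min (max ((1 / 2 : ℝ) * ∑ b : Fin D, (Y pn b) ^ 2) 0) (M : ℝ) ∂(curvatureGaussianField 4 D)) -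
        (∫ Y, min (max ((1 / 2 : ℝ) * ∑ a : Fin D, (Y p0 a) ^ 2) 0) (M : ℝ) ∂(curvatureGaussianField 4 D)) *
          (∫ Y, min (max ((1 / 2 : ℝ) * ∑ b : Fin D, (Y pn b) ^ 2) 0) (M : ℝ) ∂(curvatureGaussianField 4 D)))
        L < ε / 3 ∧
      (96 * C + 32 * C ^ 2) / (M : ℝ) < ε / 3 :=
    ((eventually_ge_atTop 1).and (((Metric.tendsto_nhds.1 hGauss) (ε / 3) hε3).and
      (hKM.eventually (gt_mem_nhds hε3)))).exists
  have hM0 : (0 : ℝ) < M := by exact_mod_cast hM1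
  rw [Real.dist_eq] at hMG
  -- (T0) at the two plaquettes with the truncated test functions
  set cM : ℝ → ℝ := fun t => min (max t 0) (M : ℝ) with hcM
  have hcMc : Continuous cM := GaussMoments.continuous_clamp (M : ℝ)
  have hcMb : ∀ t, |cM t| ≤ M := fun t => GaussMoments.abs_clamp_le t (Nat.cast_nonneg M)
  set f2 : (Fin 2 → ℝ) → ℝ := fun v => cM (v 0) * cM (v 1) with hf2
  set fa : (Fin 2 → ℝ) → ℝ := fun v => cM (v 0) with hfa
  set fb : (Fin 2 → ℝ) → ℝ := fun v => cM (v 1) with hfb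
  have hf2c : Continuous f2 := (hcMc.comp (continuous_apply 0)).mul (hcMc.comp (continuous_apply 1))
  have hfac : Continuous fa := hcMc.comp (continuous_apply 0)
  have hfbc : Continuous fb := hcMc.comp (continuous_apply 1)
  have hf2b : ∃ C' : ℝ, ∀ v, |f2 v| ≤ C' := ⟨(M : ℝ) * M, fun v => by
    simp only [hf2, abs_mul]
    exact mul_le_mul (hcMb _) (hcMb _) (abs_nonneg _) (Nat.cast_nonneg M)⟩
  have hfab : ∃ C' : ℝ, ∀ v, |fa v| ≤ C' := ⟨M, fun v => hcMb _⟩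
  have hfbb : ∃ C' : ℝ, ∀ v, |fb v| ≤ C' := ⟨M, fun v => hcMb _⟩
  have l2 := hT0 2 ![p0, pn] f2 hf2c hf2b
  have la := hT0 2 ![p0, pn] fa hfac hfab
  have lb := hT0 2 ![p0, pn] fb hfbc hfbb
  -- identify the lattice integrands
  have hL2 : ∀ (j : ℕ) (U : LGConfig 4 G),
      f2 (fun i => βs (φ j) * ((r.N : ℝ) - plaquetteObs r.ρ
          ((![p0, pn] : Fin 2 → ZdPlaquette 4) i).1 ((![p0, pn] : Fin 2 → ZdPlaquette 4) i).2.1.1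
          ((![p0, pn] : Fin 2 → ZdPlaquette 4) i).2.1.2 U)) =
        cM (X (φ j) p0 U) * cM (X (φ j) pn U) := by
    intro j U
    simp only [hf2, hX, Matrix.cons_val_zero, Matrix.cons_val_one, Matrix.cons_val_fin_one]
  have hLa : ∀ (j : ℕ) (U : LGConfig 4 G),
      fa (fun i => βs (φ j) * ((r.N : ℝ) - plaquetteObs r.ρ
          ((![p0, pn] : Fin 2 → ZdPlaquette 4) i).1 ((![p0, pn] : Fin 2 → ZdPlaquette 4) i).2.1.1
          ((![p0, pn] : Fin 2 → ZdPlaquette 4) i).2.1.2 U)) = cM (X (φ j) p0 U) := by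
    intro j U
    simp only [hfa, hX, Matrix.cons_val_zero]
  have hLb : ∀ (j : ℕ) (U : LGConfig 4 G),
      fb (fun i => βs (φ j) * ((r.N : ℝ) - plaquetteObs r.ρ
          ((![p0, pn] : Fin 2 → ZdPlaquette 4) i).1 ((![p0, pn] : Fin 2 → ZdPlaquette 4) i).2.1.1
          ((![p0, pn] : Fin 2 → ZdPlaquette 4) i).2.1.2 U)) = cM (X (φ j) pn U) := by
    intro j U
    simp only [hfb, hX, Matrix.cons_val_one, Matrix.cons_val_fin_one]
  -- identify the Gaussian integrands
  have hG2 : ∀ Y : ZdPlaquette 4 → Fin D → ℝ,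
      f2 (fun i => (1 / 2 : ℝ) * ∑ a : Fin D, (Y ((![p0, pn] : Fin 2 → ZdPlaquette 4) i) a) ^ 2) =
        cM ((1 / 2 : ℝ) * ∑ a : Fin D, (Y p0 a) ^ 2) * cM ((1 / 2 : ℝ) * ∑ b : Fin D, (Y pn b) ^ 2) := by
    intro Y
    simp only [hf2, Matrix.cons_val_zero, Matrix.cons_val_one, Matrix.cons_val_fin_one]
  have hGa : ∀ Y : ZdPlaquette 4 → Fin D → ℝ,
      fa (fun i => (1 / 2 : ℝ) * ∑ a : Fin D, (Y ((![p0, pn] : Fin 2 → ZdPlaquette 4) i) a) ^ 2) =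
        cM ((1 / 2 : ℝ) * ∑ a : Fin D, (Y p0 a) ^ 2) := by
    intro Y
    simp only [hfa, Matrix.cons_val_zero]
  have hGb : ∀ Y : ZdPlaquette 4 → Fin D → ℝ,
      fb (fun i => (1 / 2 : ℝ) * ∑ a : Fin D, (Y ((![p0, pn] : Fin 2 → ZdPlaquette 4) i) a) ^ 2) =
        cM ((1 / 2 : ℝ) * ∑ b : Fin D, (Y pn b) ^ 2) := by
    intro Y
    simp only [hfb, Matrix.cons_val_one, Matrix.cons_val_fin_one]
  simp only [hL2, hG2] at l2
  simp only [hLa, hGa] at la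
  simp only [hLb, hGb] at lb
  have lcov := l2.sub (la.mul lb)
  have hev := (Metric.tendsto_nhds.1 lcov) (ε / 3) hε3
  obtain ⟨j, hj⟩ := hev.exists
  rw [Real.dist_eq] at hj
  -- combine at `k = φ j`
  have hk := hbad (φ j)
  have h1 := htrunc (φ j) hM0
  rw [hcov (φ j)] at h1
  simp only [hcM] at hj
  have htri := abs_sub_le (βs (φ j) ^ 2 * plaquetteCorr r.ρ (μs (φ j)) p0.1 p0.2.1.1 p0.2.1.2 pn.1 pn.2.1.1 pn.2.1.2)
    ((∫ U, min (max (X (φ j) p0 U) 0) M * min (max (X (φ j) pn U) 0) M ∂(μs (φ j))) -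
      (∫ U, min (max (X (φ j) p0 U) 0) M ∂(μs (φ j))) * (∫ U, min (max (X (φ j) pn U) 0) M ∂(μs (φ j)))) L
  have htri2 := abs_sub_le
    ((∫ U, min (max (X (φ j) p0 U) 0) M * min (max (X (φ j) pn U) 0) M ∂(μs (φ j))) -
      (∫ U, min (max (X (φ j) p0 U) 0) M ∂(μs (φ j))) * (∫ U, min (max (X (φ j) pn U) 0) M ∂(μs (φ j))))
    ((∫ Y, min (max ((1 / 2 : ℝ) * ∑ a : Fin D, (Y p0 a) ^ 2) 0) (M : ℝ) *
          min (max ((1 / 2 : ℝ) * ∑ b : Fin D, (Y pn b) ^ 2) 0) (M : ℝ) ∂(curvatureGaussianField 4 D)) -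
        (∫ Y, min (max ((1 / 2 : ℝ) * ∑ a : Fin D, (Y p0 a) ^ 2) 0) (M : ℝ) ∂(curvatureGaussianField 4 D)) *
          (∫ Y, min (max ((1 / 2 : ℝ) * ∑ b : Fin D, (Y pn b) ^ 2) 0) (M : ℝ) ∂(curvatureGaussianField 4 D))) L
  linarith


end PairLaw

end Summit.QuantumFields.YangMills.Theorems.HankelDensitySplitting

end
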